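import Mathlib
import Literature.Analysis.FluidPDE.SuitableWeak
import Literature.Analysis.FluidPDE.EulerVorticitySupportVolume
import Literature.Analysis.FluidPDE.FlatSwirlGauge
import Literature.Analysis.FluidPDE.WholeSpaceIBP
import Literature.Analysis.FunctionSpaces.SobolevDomainProofs
import Summits.NavierStokesRegularity.NavierStokesRegularity.Theorems.EulerZoomLiouvillePowerGaugeEulerLiouvilleIrrotational
import Summits.NavierStokesRegularity.NavierStokesRegularity.Theorems.EulerZoomLiouvillePowerGaugeEulerLiouvilleSelfSimilarTransfer
import Summits.NavierStokesRegularity.NavierStokesRegularity.Theorems.EulerZoomLiouvillePowerGaugeEulerLiouvilleSelfSimilarVorticity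
import HarnessLib

/-!
# Rung C2 of the crux `EulerZoomLiouville.PowerGaugeEulerLiouville`: no discretely self-similar
# Euler collapse with compactly supported vorticity

Route №10 `EulerZoomLiouville` (NavierStokesRegularity), crux E = stmt-NavierStokesRegularity-19832
(`PowerGaugeEulerLiouville`), tenure rung C2 (`Sig.rungC2_dss`: discretely self-similar members of
Seregin's power-gauged ancient Euler class vanish; "no print inside the window"). This file lands the
first stratum of rung C2 whose lever is the MOMENTUM identity (vorticity transport): a classical
DSS member whose vorticity has compact spatial support (locally uniformly in time) is trivial, for
EVERY exponent and EVERY scaling factor.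

* `vorticity_eq_zero_of_dss_of_compactSupport` — **physical-variable theorem**: a classical
  solution of the Euler vorticity formulation on the past `(−∞, 0)` (`IsVorticitySolutionOn (Iio 0) 0 u`)
  that is discretely self-similar, `u(τ, y) = l^{1+ρ} u(l^{2+ρ} τ, l y)` for `τ < 0` (`l > 1`,
  `2 + ρ > 0`), and whose vorticity is supported in a compact set on every compact time interval, is
  IRROTATIONAL: `vorticity u τ = 0` for all `τ < 0`. Proof: the vorticity-support volume is conserved
  along `[l^{2+ρ}τ₀, τ₀]` (tree `IsVorticitySolutionOn.volume_support_vorticity_eq`, the Eulerian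
  form of Helmholtz's transport of vortex lines by the volume-preserving flow), while the DSS law
  gives `supp ω(τ₀) = l⁻¹ · supp ω(l^{2+ρ}τ₀)`, i.e. the volume shrinks by `l^{−3}` over the same
  period; a finite volume `V` with `V = l^{−3} V` is zero, so `ω(τ₀) = 0` a.e., hence everywhere.
* `dss_ae_eq_zero_of_compactSupport_vorticity` — **the stratum**: a member of the power-gauged class
  (the three clauses of the route crux at exponent `ρ > 0`) which is a classical Euler solution on the
  open past, DSS with factor `l > 1`, and has compactly supported vorticity locally uniformly in time,
  vanishes a.e. on the slab: by the previous theorem it is irrotational; its weak gradient `H` agrees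
  a.e. with the (symmetric) classical gradient (uniqueness of weak gradients, slice by slice), so the
  lead's irrotational stratum `ae_eq_zero_of_gauge_of_irrotational` (harmonic Liouville under the
  `A`-gauge growth) applies.

WHAT THIS IS NOT: not NS, not E, not rung C2 whole — DSS members with the natural vorticity tail are
untouched, and `IsClassicalEulerSolutionOn` / the uniform compact support are genuine restrictions
(the suitable weak class allows rough members). No decay, energy or symmetry hypothesis is used.

## References

* A. J. Majda, A. L. Bertozzi, *Vorticity and Incompressible Flow* (CUP 2002), §1.6 Prop. 1.8
  (vorticity transport). [MajdaBertozziCUP2002]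
* D. Chae, R. Shvydkoy, ARMA 209 (2013) = arXiv:1201.6009, §4 (Chae's support argument [cha]).
  [ChaeShvydkoy2013]
-/

noncomputable section

set_option linter.dupNamespace false

open MeasureTheory Set Filter Topology Metric Function
open scoped ENNReal NNReal InnerProductSpace RealInnerProductSpace Pointwise

namespace Summit.NavierStokesRegularity.NavierStokesRegularity.Theorems.PowerGaugeEulerLiouville

open Literature.Analysis Literature.Analysis.FunctionSpaces Literature.Analysis.FluidPDE

/-! ## Physical variables: a DSS Euler flow with compactly supported vorticity is irrotational -/

/-- **A discretely self-similar classical Euler flow with compactly supported vorticity is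
irrotational.** Let `u` solve the Euler vorticity formulation on the past `(−∞, 0)`
(`∂ₜω + (u·∇)ω = (ω·∇)u`, `div u = 0`, jointly smooth), be discretely self-similar,
`u(τ, y) = l^{1+ρ} • u(l^{2+ρ} τ, l • y)` for all `τ < 0` with `l > 1`, `2 + ρ > 0`, and assume that
on every compact time interval `[τ₁, τ₂] ⊂ (−∞, 0)` the vorticity vanishes off some compact set.
Then `vorticity u τ = 0` for every `τ < 0`. (Support volume conserved — tree
`IsVorticitySolutionOn.volume_support_vorticity_eq` — versus scaled by `l^{−3}` over one period.)
[cite: MajdaBertozziCUP2002, §1.6 Prop. 1.8 (eq. (1.51))] -/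
theorem vorticity_eq_zero_of_dss_of_compactSupport {ρ l : ℝ} (hρ : 0 < 2 + ρ) (hl : 1 < l)
    {u : ℝ → EuclideanSpace ℝ (Fin 3) → EuclideanSpace ℝ (Fin 3)}
    (h : IsVorticitySolutionOn (Iio 0) 0 u)
    (hdss : ∀ τ : ℝ, τ < 0 → ∀ y, u τ y = (l ^ (1 + ρ)) • u ((l ^ (2 + ρ)) * τ) (l • y))
    (hsupp : ∀ τ₁ τ₂ : ℝ, τ₁ ≤ τ₂ → τ₂ < 0 → ∃ K : Set (EuclideanSpace ℝ (Fin 3)),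
      IsCompact K ∧ ∀ σ ∈ Icc τ₁ τ₂, ∀ x ∉ K, vorticity u σ x = 0)
    {τ : ℝ} (hτ : τ < 0) : vorticity u τ = 0 := by
  have hl0 : 0 < l := zero_lt_one.trans hl
  have hL : 1 < l ^ (2 + ρ) := Real.one_lt_rpow hl hρ
  set τ' : ℝ := l ^ (2 + ρ) * τ with hτ'
  have hτ'τ : τ' < τ := by rw [hτ']; nlinarith
  have hτ'0 : τ' < 0 := hτ'τ.trans hτ
  obtain ⟨K, hK, hsuppK⟩ := hsupp τ' τ hτ'τ.le hτ
  -- conservation of the support volume over `[τ', τ]`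
  have hvol := h.volume_support_vorticity_eq isOpen_Iio hτ'τ.le
    (fun σ hσ => lt_of_le_of_lt hσ.2 hτ) hK hsuppK
  -- the DSS law for the vorticity: `ω(τ, y) = l^{2+ρ} ω(τ', l y)`
  have hcurl : ∀ y, vorticity u τ y = (l ^ (1 + ρ) * l) • vorticity u τ' (l • y) := by
    intro y
    have hfun : u τ = fun y => (l ^ (1 + ρ)) • u τ' (l • y) := funext fun y => hdss τ hτ y
    rw [vorticity_apply, vorticity_apply, hfun, curl_smul_comp_smul]
  have hc0 : l ^ (1 + ρ) * l ≠ 0 := (mul_pos (Real.rpow_pos_of_pos hl0 _) hl0).ne'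
  have hset : {y | vorticity u τ y ≠ 0} = (fun y => l • y) ⁻¹' {x | vorticity u τ' x ≠ 0} := by
    ext y
    simp only [mem_setOf_eq, mem_preimage, hcurl y, ne_eq, smul_eq_zero, hc0, false_or]
  -- hence `vol = l^{-3} vol`
  have hscale : volume {y | vorticity u τ y ≠ 0} =
      ENNReal.ofReal (|(l ^ Module.finrank ℝ (EuclideanSpace ℝ (Fin 3)))⁻¹|) *
        volume {x | vorticity u τ' x ≠ 0} := by
    rw [hset, Measure.addHaar_preimage_smul volume hl0.ne']
  rw [finrank_euclideanSpace_fin] at hscale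
  -- finiteness
  have hsub' : {x | vorticity u τ' x ≠ 0} ⊆ K := fun x hx => by
    by_contra hxK; exact hx (hsuppK τ' (left_mem_Icc.2 hτ'τ.le) x hxK)
  have hfin : volume {x | vorticity u τ' x ≠ 0} ≠ ⊤ :=
    ((measure_mono hsub').trans_lt hK.measure_lt_top).ne
  -- `V = l^{-3} V` with `V < ∞` forces `V = 0`
  have hV0 : volume {x | vorticity u τ' x ≠ 0} = 0 := by
    rw [hvol] at hscale
    set V := volume {x | vorticity u τ' x ≠ 0} with hV
    have hreal : V.toReal = (l ^ 3)⁻¹ * V.toReal := by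
      have e := congrArg ENNReal.toReal hscale
      rwa [ENNReal.toReal_mul, abs_of_pos (by positivity), ENNReal.toReal_ofReal (by positivity)]
        at e
    have hl3 : (l ^ 3)⁻¹ < 1 := inv_lt_one_of_one_lt₀ (one_lt_pow₀ hl three_ne_zero)
    have h1 : (1 - (l ^ 3)⁻¹) * V.toReal = 0 := by
      rw [sub_mul, one_mul, ← hreal, sub_self]
    rcases mul_eq_zero.1 h1 with h2 | h2
    · exact absurd h2 (by linarith)
    · rcases (ENNReal.toReal_eq_zero_iff V).1 h2 with h3 | h3
      · exact h3
      · exact absurd h3 hfin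
  have hVτ : volume {y | vorticity u τ y ≠ 0} = 0 := by rw [hvol, hV0]
  -- a.e. zero and continuous, hence zero
  have hae : vorticity u τ =ᵐ[volume] 0 := by
    have : ∀ᵐ y ∂(volume : Measure (EuclideanSpace ℝ (Fin 3))), ¬ (vorticity u τ y ≠ 0) :=
      measure_eq_zero_iff_ae_notMem.1 hVτ
    filter_upwards [this] with y hy
    simpa using hy
  have hcont : Continuous (vorticity u τ) :=
    ((h.smooth_velocity.isSmoothSpaceTimeOn_vorticity isOpen_Iio.uniqueDiffOn).contDiff_slice
      hτ).continuous
  exact (hcont.ae_eq_iff_eq volume continuous_zero).1 hae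

/-! ## The stratum -/

/-- **Rung C2, compact-vorticity stratum (every `ρ > 0`, every `l > 1`): no discretely self-similar
Euler collapse in the power-gauged class with a classical velocity whose vorticity has compact
spatial support locally uniformly in time.** Hypotheses: the three clauses of the route crux
`EulerZoomLiouville.PowerGaugeEulerLiouville` for `(u, p, H, c)` at exponent `ρ`; `(u, p)` a
classical Euler solution on the open past (`IsClassicalEulerSolutionOn (Iio 0) 0 u p`); the DSS law
`u(τ, y) = l^{1+ρ} • u(l^{2+ρ}τ, l • y)` (`τ < 0`); compact vorticity support on compact time
intervals. Then `u = 0` a.e. on the slab. Proof: `vorticity u ≡ 0` by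
`vorticity_eq_zero_of_dss_of_compactSupport`; the weak gradient `H` agrees a.e. with the classical
gradient (`HasWeakFDerivOn.unique_holds` slice by slice, `ae_eq_prod_of_ae_ae_eq`), which is
symmetric where the curl vanishes (`inner_fderiv_comm_of_curl_eq_zero`); conclude by the lead's
irrotational stratum `ae_eq_zero_of_gauge_of_irrotational`. [cite: MajdaBertozziCUP2002, §1.6 Prop. 1.8 (eq. (1.51))] -/
theorem dss_ae_eq_zero_of_compactSupport_vorticity {ρ l : ℝ} (hρ : 0 < ρ) (hl : 1 < l)
    (u : ℝ → EuclideanSpace ℝ (Fin 3) → EuclideanSpace ℝ (Fin 3))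
    (p : ℝ → EuclideanSpace ℝ (Fin 3) → ℝ)
    (H : ℝ → EuclideanSpace ℝ (Fin 3) → EuclideanSpace ℝ (Fin 3) →L[ℝ] EuclideanSpace ℝ (Fin 3))
    (c : ℝ≥0)
    (hsw : IsSuitableWeakSolutionOn (slab (EuclideanSpace ℝ (Fin 3)) (Iio 0) isOpen_Iio) 0 0 u p)
    (hH : HasWeakSpatialGradientOn (slab (EuclideanSpace ℝ (Fin 3)) (Iio 0) isOpen_Iio) u H)
    (hgauge : ∀ a : ℝ, 0 < a →
      ENNReal.ofReal (a ^ (2 * ρ)) * cknA a (0 : ℝ × EuclideanSpace ℝ (Fin 3)) u +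
          ENNReal.ofReal (a ^ ρ) * cknE a (0 : ℝ × EuclideanSpace ℝ (Fin 3)) H +
        ENNReal.ofReal (a ^ (2 * ρ)) * cknD a (0 : ℝ × EuclideanSpace ℝ (Fin 3)) p ≤ (c : ℝ≥0∞))
    (hcl : IsClassicalEulerSolutionOn (Iio 0) 0 u p)
    (hdss : ∀ τ : ℝ, τ < 0 → ∀ y, u τ y = (l ^ (1 + ρ)) • u ((l ^ (2 + ρ)) * τ) (l • y))
    (hsupp : ∀ τ₁ τ₂ : ℝ, τ₁ ≤ τ₂ → τ₂ < 0 → ∃ K : Set (EuclideanSpace ℝ (Fin 3)),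
      IsCompact K ∧ ∀ σ ∈ Icc τ₁ τ₂, ∀ x ∉ K, vorticity u σ x = 0) :
    uncurry u =ᵐ[volume.restrict (Iio (0 : ℝ) ×ˢ (univ : Set (EuclideanSpace ℝ (Fin 3))))] 0 := by
  -- the vorticity formulation and irrotationality
  have hV : IsVorticitySolutionOn (Iio 0) 0 u :=
    hcl.isVorticitySolutionOn_of_isOpen isOpen_Iio fun t _ x => curl_fun_zero x
  have hω0 : ∀ τ : ℝ, τ < 0 → vorticity u τ = 0 := fun τ hτ =>
    vorticity_eq_zero_of_dss_of_compactSupport (by linarith) hl hV hdss hsupp hτ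
  have hcurl : ∀ τ : ℝ, τ < 0 → ∀ x, curl (u τ) x = 0 := fun τ hτ x => by
    rw [← vorticity_apply]; exact congrFun (hω0 τ hτ) x
  -- the weak gradient agrees a.e. with the classical one, slice by slice
  have h1 := ae_hasWeakGradient_slice_of_slab hH
  have h2 : ∀ᵐ t ∂(volume.restrict (Iio (0 : ℝ))),
      (fun x => H t x) =ᵐ[volume] fun x => fderiv ℝ (u t) x := by
    filter_upwards [h1, ae_restrict_mem measurableSet_Iio] with t ht htneg
    have hcl1 : ContDiff ℝ 1 (u t) := (hcl.contDiff_velocity htneg).of_le (by exact_mod_cast le_top)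
    have hw : HasWeakGradient (u t) (fderiv ℝ (u t)) := hasWeakGradient_fderiv_of_contDiff hcl1
    have := HasWeakFDerivOn.unique_holds ht hw
    rwa [TopologicalSpace.Opens.coe_top, Measure.restrict_univ] at this
  -- measurability on the product and the a.e. identification `H = ∇u` on the slab
  have hμ : (volume : Measure (ℝ × EuclideanSpace ℝ (Fin 3))).restrict
      (Iio (0 : ℝ) ×ˢ (univ : Set (EuclideanSpace ℝ (Fin 3)))) =
      (volume.restrict (Iio (0 : ℝ))).prod (volume : Measure (EuclideanSpace ℝ (Fin 3))) := by
    rw [Measure.volume_eq_prod, Measure.restrict_prod_eq_prod_univ]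
  have hHm : AEStronglyMeasurable (uncurry H)
      ((volume.restrict (Iio (0 : ℝ))).prod (volume : Measure (EuclideanSpace ℝ (Fin 3)))) := by
    have := hH.locallyIntegrableOn_grad.aestronglyMeasurable
    rw [← hμ]; simpa [slab] using this
  have hGcont : ContinuousOn (uncurry fun t x => fderiv ℝ (u t) x)
      (Iio (0 : ℝ) ×ˢ (univ : Set (EuclideanSpace ℝ (Fin 3)))) :=
    (hcl.smooth_velocity.fderiv_slice isOpen_Iio.uniqueDiffOn).continuousOn
  have hGm : AEStronglyMeasurable (uncurry fun t x => fderiv ℝ (u t) x)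
      ((volume.restrict (Iio (0 : ℝ))).prod (volume : Measure (EuclideanSpace ℝ (Fin 3)))) := by
    rw [← hμ]
    exact hGcont.aestronglyMeasurable (measurableSet_Iio.prod MeasurableSet.univ)
  have hHG : uncurry H =ᵐ[(volume.restrict (Iio (0 : ℝ))).prod volume]
      uncurry fun t x => fderiv ℝ (u t) x :=
    ae_eq_prod_of_ae_ae_eq hHm hGm h2
  -- symmetry a.e. on the slab
  have hsym : ∀ᵐ z ∂(volume.restrict (Iio (0 : ℝ) ×ˢ (univ : Set (EuclideanSpace ℝ (Fin 3))))),
      ∀ v w : EuclideanSpace ℝ (Fin 3), ⟪H z.1 z.2 v, w⟫ = ⟪H z.1 z.2 w, v⟫ := by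
    rw [hμ]
    have hmem : ∀ᵐ z ∂((volume.restrict (Iio (0 : ℝ))).prod
        (volume : Measure (EuclideanSpace ℝ (Fin 3)))), z.1 < 0 := by
      rw [← hμ]
      filter_upwards [ae_restrict_mem (measurableSet_Iio.prod MeasurableSet.univ)] with z hz
      exact hz.1
    filter_upwards [hHG, hmem] with z hz hzneg v w
    have e : H z.1 z.2 = fderiv ℝ (u z.1) z.2 := hz
    rw [e]
    exact inner_fderiv_comm_of_curl_eq_zero
      (((hcl.contDiff_velocity hzneg).differentiable (by simp)) z.2) (hcurl z.1 hzneg z.2) v w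
  exact ae_eq_zero_of_gauge_of_irrotational (by linarith) hsw hH hgauge hsym

end Summit.NavierStokesRegularity.NavierStokesRegularity.Theorems.PowerGaugeEulerLiouville

end
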